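/-
Copyright (c) 2026 the pub-hodgecm-mathlib formalisation cell (harness21).  Prover seat hodgecm-mathlib-LH7-p09 (g3), CLOSE-OUT ROSTER strike line L3∕L5 (Track A
«(D-RAM) FOUR-FRAME» squad F0∕P3c∕LH4 ∕ F0∕P3c∕LH7); β₂ WORDs #34∕#36 «THE MIX-HI WALL — ONE SOCKET FAMILY {hU_mix, hD_mix, ‹hL_mix_hi›}» (lead LH4-p13 (g10), second
LH7-p09 (g3)); helper lane on h413 = stmt-HodgeConjecture-24833 (count-neutral).  2026-09-05.
-/
import Summits.HodgeConjecture.HodgeConjecture.Theorems.F0P3cDyRamConeCellFaceTubeAbove   -- ★ p861237 (LH4-p16 (g0)): HEAD-hi `finsum_levelSetDep_inter_weight_eq_iff_of_le`, §3 `weight_smul_ne_zero_iff_weight_eq_zero_of_le`; brings ★ `…ConeCellFlipBalance`, ★ `…ConeCellLabelBalance`, ★ `…ConeWeightHalfSplit`, ★ DEFS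
import HarnessLib

/-!
# Crux `H413`, line LH4 «(D-RAM) FOUR-FRAME» — STAGE-1b, row (2) of `f_{T₊}`, the (β₂) road (R-36), the MIX-HI WALL (β₂ WORDs #34∕#36): «THE PRODUCT SOCKET OF A CONE CELL AT
# AND ABOVE THE GLUE CONDUCTOR» — on a cell `levelSetDep(j, b; μ)` with `d ≤ b` the weighted two-literal difference VANISHES as soon as the PRODUCT character `Π` (glue class ×
# label class) is BALANCED over the WHOLE cell: the exact ω-flip pairs the populated `Π`-part with the unpopulated `Π`-part

Cell `hodgecm-mathlib` (D-0151), FLOOR 0, crux item H413 = `stmt-HodgeConjecture-24833`, route of record `HCCMUnconditional`; squads F0∕P3c∕LH4 ∕ LH7; lane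
`--supports stmt-HodgeConjecture-24833 --as helper` (count-neutral; pays NO tier-0 row).  THEOREMS ONLY (no `def`, no instance, no notation, no `sorry`, default heartbeats);
★-only imports; states NO law; (β₂) and the MIX-HI band letters stay HYPOTHESES.  Frame of §2–§3 = ★ `…ConeCellFaceTubeAbove` §3's VERBATIM (E-side wild datum of ★ T1, line
model, ★ (C1)'s weight letter `hf`, `u : E`, `1 ≤ b`, `d ≤ b`, the flip unit `z`, `z·Θz = jE ξ`, `ξ` a `σ`-fixed NON-norm).

WHY (β₂ sub-dealer LH4-p04 (g10) WORD #36 «A SOCKET FOR THE MIX-HI WALL»; LH4-p13 (g10) SCOPE FINDING 01:29Z; this seat's census 01:36Z).  At `d ≤ b` the glue weight of a cell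
member is `2q^b` or `0` (★ HEAD-hi), and the exact ω-flip `Λ ↦ z • Λ` REVERSES populatedness (★ `weight_smul_ne_zero_iff_weight_eq_zero_of_le`) while reversing the label
(★ p863829) — so it moves BOTH characters and pays no weighted face by itself (★ §3 tightness).  But the PRODUCT `Π` = (glue class)·(label class) is PRESERVED by the flip
(both factors divide by the same `ξ`, §3), hence with `a = #{pop ∧ Π}`, `b′ = #{pop ∧ ¬Π}`, `c = #{unpop ∧ Π}`, `e = #{unpop ∧ ¬Π}` the flip gives `a = c`, `b′ = e`, and
`X(j, b) = 2q^b·(a − b′) = q^b·(#{Π} − #{¬Π})`: **the band letter is the balance of ONE character over the WHOLE cell** (WORD #36's cut, no restriction to populated members,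
no second involution).  On the lower line `Π(Λ) = ω(−h_W)·ω((â + b̂·V(Λ))∕t₊)` is an AFFINE SIGN of the cell coordinate (★ `rayScalar_eq_affine` × ★ DEFS `glueUnit`; the
class constant `ω(pw)` cancels), so ‹PRODBAL› is a digit sum — NOT claimed here.
* §1 (abstract) `ncard_sep_and_eq_of_supportReversing_of_invariant` — a finite set `S`, a weight `w`, a predicate `Π`, a bijection `τ` of `S` REVERSING the support of `w` and
  PRESERVING `Π`, and `#{S ∣ Π} = #{S ∣ ¬Π}` ⟹ `#{S ∣ w ≠ 0 ∧ Π} = #{S ∣ w ≠ 0 ∧ ¬Π}`.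
* §2 HEAD `cellDiff_eq_zero_of_flip_of_prodBalance` — THE PRODUCT SOCKET: ★ `…FaceTubeAbove` §3's frame VERBATIM + `hfin` (the cell is finite) + ONE cell predicate `Π` with the flip
  letter `hPc : Π (z • Λ) ↔ Π Λ` and the balance `hbal : #{cell ∣ Π} = #{cell ∣ ¬Π}` + the two reads on POPULATED members (`f ≠ 0 → (P₁ ↔ Π)`, `f ≠ 0 → (Q₁ ↔ ¬Π)`) ⟹
  `((Σᶠ_{cell ∩ P₁} f : ℕ) : ℤ) − ((Σᶠ_{cell ∩ Q₁} f : ℕ) : ℤ) = 0` in the ‹OFF›∕‹beta2Cones› bytes.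
* §3 THE FLIP LETTER OF THE PRODUCT (exact, datum-free): `rayTrace_mul_left` — `Tr_ρ(μ∕(cc·δ·Θ(dualGen(z·x₀)))) = Tr_ρ(μ∕(cc·δ·ΘY))∕ξ'` (`z·Θz = ξ'`, `ρξ' = ξ'`) — and
  `glueUnit_mul_rayTrace_mul_left` — `glueUnit(z·x₀)·e₀(z·x₀) = (glueUnit(x₀)·e₀(x₀))∕ξ'²` (with ★ `glueUnit_mul_left`): the product class is flip-invariant since `ξ'² = N(ξ')`.
HONEST LABEL.  Count-neutral bookkeeping + algebra; every mathematical input (`Π`, its flip letter, its balance, the reads) is a HYPOTHESIS; nothing printed is asserted; no census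
law is stated; the MIX-HI letters, (OFF), (β₂) `stub_law_cleanSgn₂` stay OPEN ∕ UNPROVED; `HC_CM` is proved only modulo the 7 printed citations (2 remaining named inputs: hLiu418 =
`stmt-HodgeConjecture-24832`, h413 = `stmt-HodgeConjecture-24833`) until rung 0 closes.
## References
* [Kottwitz1986BaseChangeUnits] R. E. Kottwitz, *Base change for unit elements of Hecke algebras*, Compositio Math. 60 (1986): §1 pp. 240–241 (signed fixed-lattice counts).
* [LabesseLanglands1979] J.-P. Labesse, R. P. Langlands, *L-indistinguishability for SL(2)*, Canad. J. Math. 31 (1979): §2 p. 8 (the norm-residue dichotomy; κ-signed counts).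
* [Rogawski1990] J. D. Rogawski, *Automorphic Representations of Unitary Groups in Three Variables*, Ann. of Math. Stud. 123 (1990): §4.9 Prop. 4.9.1 (b) p. 55.
* [Jacobowitz1962] R. Jacobowitz, *Hermitian forms over local fields*, Amer. J. Math. 84 (1962): §4 (dual lattices, gluing, the glue unit).
* [Serre1979] J.-P. Serre, *Local Fields*, GTM 67 (1979): Ch. V §3 Prop. 5, Cor. 2–3 pp. 84–86 (norm classes of units in a ramified quadratic extension).
-/

set_option autoImplicit false

noncomputable section

open scoped Pointwise Valued WithZero Matrix MatrixGroups
open WithZero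
open scoped Classical
open Literature.NumberTheory.Automorphic Literature.NumberTheory.Automorphic.HermitianLattice Literature.NumberTheory.Automorphic.UnitaryLatticeTree
open Literature.NumberTheory.Automorphic.UnitaryThreeFourFrame (IsRamifiedQuadraticDatum)
open Literature.NumberTheory.Automorphic.EllipticPlaneAsFieldLine
open Literature.NumberTheory.LocalFields.QuadraticOrder
open Literature.NumberTheory.LocalFields.WildQuadraticDatum
open Summit.HodgeConjecture.HodgeConjecture.Cruxes.H413.F0P3cDyRamToricCensusDefs
open Summit.HodgeConjecture.HodgeConjecture.Cruxes.H413.F0P3cDyRamConeCellLabelBalance (ncard_sep_eq_ncard_sep_of_equiv)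
open Summit.HodgeConjecture.HodgeConjecture.Cruxes.H413.F0P3cDyRamConeWeightHalfSplit
open Summit.HodgeConjecture.HodgeConjecture.Cruxes.H413.F0P3cDyRamConeCellFlipBalance
open Summit.HodgeConjecture.HodgeConjecture.Cruxes.H413.F0P3cDyRamConeCellFaceTubeAbove (finsum_levelSetDep_inter_weight_eq_iff_of_le weight_smul_ne_zero_iff_weight_eq_zero_of_le)

namespace Summit.HodgeConjecture.HodgeConjecture.Cruxes.H413.F0P3cDyRamConeCellProductSocket

/-! ## §1 Abstract: a support-reversing, `Π`-preserving bijection and the balance of `Π` force the balance of `Π` on the support -/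

section Abstract

variable {X : Type*}

/-- **A SUPPORT-REVERSING, `Π`-PRESERVING BIJECTION TRANSPORTS THE `Π`-BALANCE TO THE SUPPORT.**  `S` finite; `τ : X ≃ X` preserves `S`, REVERSES the support of `w` on `S`
(`w (τ x) ≠ 0 ↔ w x = 0`) and PRESERVES the predicate `Pc` (`Pc (τ x) ↔ Pc x`); then `#{S ∣ Pc} = #{S ∣ ¬Pc}` implies `#{S ∣ w ≠ 0 ∧ Pc} = #{S ∣ w ≠ 0 ∧ ¬Pc}`
(`τ` pairs `{w ≠ 0 ∧ Pc}` with `{w = 0 ∧ Pc}` and `{w ≠ 0 ∧ ¬Pc}` with `{w = 0 ∧ ¬Pc}`, so both halves of `S` split evenly). [cite: Kottwitz1986BaseChangeUnits, §1 pp. 240–241] [cite: LabesseLanglands1979, §2 p. 8] -/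
theorem ncard_sep_and_eq_of_supportReversing_of_invariant (S : Set X) (hS : S.Finite) (τ : X ≃ X) (hτ : ∀ x, τ x ∈ S ↔ x ∈ S)
    (w : X → ℕ) (Pc : X → Prop) (hrev : ∀ x ∈ S, w (τ x) ≠ 0 ↔ w x = 0) (hPc : ∀ x ∈ S, Pc (τ x) ↔ Pc x)
    (hbal : {x ∈ S | Pc x}.ncard = {x ∈ S | ¬ Pc x}.ncard) :
    {x ∈ S | w x ≠ 0 ∧ Pc x}.ncard = {x ∈ S | w x ≠ 0 ∧ ¬ Pc x}.ncard := by
  -- the flip pairs the populated `φ`-part with the unpopulated `φ`-part, for `φ = Π` and `φ = ¬Π`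
  have hpair : ∀ φ : X → Prop, (∀ x ∈ S, φ (τ x) ↔ φ x) →
      {x ∈ S | w x ≠ 0 ∧ φ x}.ncard = {x ∈ S | w x = 0 ∧ φ x}.ncard := by
    intro φ hφ
    refine ncard_sep_eq_ncard_sep_of_equiv S τ hτ (fun x => w x ≠ 0 ∧ φ x) (fun x => w x = 0 ∧ φ x) (fun x hx hP => ?_) (fun y hy hQ => ?_)
    · refine ⟨?_, (hφ x hx).2 hP.2⟩
      by_contra hne
      exact hP.1 ((hrev x hx).1 hne)
    · have hyS : τ.symm y ∈ S := (hτ (τ.symm y)).1 (by rw [τ.apply_symm_apply]; exact hy)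
      refine ⟨fun h0 => ?_, ?_⟩
      · have h1 := (hrev (τ.symm y) hyS).2 h0
        rw [τ.apply_symm_apply] at h1
        exact h1 hQ.1
      · have h1 := (hφ (τ.symm y) hyS)
        rw [τ.apply_symm_apply] at h1
        exact h1.1 hQ.2
  -- each `φ`-half of `S` is the disjoint union of its populated and unpopulated parts
  have hsplit : ∀ φ : X → Prop, {x ∈ S | φ x}.ncard = {x ∈ S | w x ≠ 0 ∧ φ x}.ncard + {x ∈ S | w x = 0 ∧ φ x}.ncard := by
    intro φ
    rw [← Set.ncard_union_eq (Set.disjoint_left.2 fun x hx hx' => hx.2.1 hx'.2.1) (hS.subset fun x hx => hx.1) (hS.subset fun x hx => hx.1)]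
    congr 1
    ext x
    simp only [Set.mem_setOf_eq, Set.mem_union]
    constructor
    · rintro ⟨hx, hφ⟩
      by_cases h0 : w x = 0
      · exact Or.inr ⟨hx, h0, hφ⟩
      · exact Or.inl ⟨hx, h0, hφ⟩
    · rintro (⟨hx, -, hφ⟩ | ⟨hx, -, hφ⟩) <;> exact ⟨hx, hφ⟩
  have h1 := hsplit Pc
  have h2 := hsplit (fun x => ¬ Pc x)
  rw [← hpair Pc hPc] at h1
  rw [← hpair (fun x => ¬ Pc x) (fun x hx => not_congr (hPc x hx))] at h2
  omega

end Abstract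

/-! ## §2 HEAD — the product socket of a cone cell at and above the glue conductor -/

section Socket

variable {E : Type} {M : Type*} [Field E] [Valued E ℤᵐ⁰] [Field M] [Valued M ℤᵐ⁰] {ρ Θ : M →+* M} {α : M}

/-- **HEAD — «THE PRODUCT SOCKET OF A CONE CELL AT AND ABOVE THE GLUE CONDUCTOR».**  Frame of ★ `…ConeCellFaceTubeAbove` §3 VERBATIM (`σ hσ hvσ ϖ hϖ d t hD h2v H₂ hH₂σ hW hhW
hhWσ jE hρρ hvρ hα hα1 hint hΘΘ hΘρ hvΘ hΘj hjv hjfix hjpow hϖmax φ hφs hφi hφo γ₂ lam h hφγ hlam hΘh hh hform`, the flip unit `z hz1 ξ hzξ hσξ hξN`, `u b hb hdb j hlamj f hf`) +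
`hfin` (the cell `levelSetDep ρ Θ α (jE ϖ) h j b (lam − jE u)` is finite) + ONE cell predicate `Pc` (the product character Π) with its FLIP LETTER `hPc : Pc (z • Λ) ↔ Pc Λ` and its BALANCE
`hbal : #{cell ∣ Pc} = #{cell ∣ ¬Pc}` + the two READS on populated members (`f b j Λ ≠ 0 → (P₁ Λ ↔ Pc Λ)`, `f b j Λ ≠ 0 → (Q₁ Λ ↔ ¬ Pc Λ)`).  THEN
`((Σᶠ_{Λ ∈ cell ∩ {P₁}} f b j Λ : ℕ) : ℤ) − ((Σᶠ_{Λ ∈ cell ∩ {Q₁}} f b j Λ : ℕ) : ℤ) = 0`.  (★ HEAD-hi reduces the weighted face to the populated parts; the exact ω-flip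
`Λ ↦ z • Λ` preserves the cell (★ `smul_mem_levelSetDep_iff_of_flip`), reverses populatedness (★ `weight_smul_ne_zero_iff_weight_eq_zero_of_le`) and preserves `Π`; §1.)
[cite: Rogawski1990, §4.9 Prop. 4.9.1 (b) p. 55] [cite: Kottwitz1986BaseChangeUnits, §1 pp. 240–241] [cite: LabesseLanglands1979, §2 p. 8] [cite: Serre1979, Ch. V §3 Prop. 5, Cor. 2–3 pp. 84–86] -/
theorem cellDiff_eq_zero_of_flip_of_prodBalance [CompleteSpace E] [IsDiscreteValuationRing 𝒪[E]] [Finite 𝓀[E]]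
    (σ : E →+* E) (hσ : ∀ a, σ (σ a) = a) (hvσ : ∀ a, Valued.v (σ a) = Valued.v a)
    {ϖ : E} (hϖ : Valued.v ϖ = WithZero.exp (-1 : ℤ)) {d t : ℕ} (hD : IsRamifiedQuadraticDatum σ ϖ d t) (h2v : Valued.v (2 : E) < 1)
    {H₂ : Matrix (Fin 2) (Fin 2) E} (hH₂σ : (H₂.map σ)ᵀ = H₂) {hW : E} (hhW : Valued.v hW = 1) (hhWσ : σ hW = hW) (jE : E →+* M)
    (hρρ : ∀ x, ρ (ρ x) = x) (hvρ : ∀ x, Valued.v (ρ x) = Valued.v x) (hα : ρ α ≠ α) (hα1 : Valued.v α ≤ 1)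
    (hint : ∀ z : M, Valued.v z ≤ 1 → Valued.v ((z - ρ z) / (α - ρ α)) ≤ 1)
    (hΘΘ : ∀ x, Θ (Θ x) = x) (hΘρ : ∀ x, Θ (ρ x) = ρ (Θ x)) (hvΘ : ∀ x, Valued.v (Θ x) = Valued.v x) (hΘj : ∀ x, Θ (jE x) = jE (σ x))
    (hjv : ∀ c, Valued.v (jE c) ≤ 1 ↔ Valued.v c ≤ 1) (hjfix : ∀ z, ρ z = z ↔ ∃ c, jE c = z)
    (hjpow : ∀ (t : E) (n : ℤ), Valued.v (jE t) = Valued.v (jE ϖ) ^ n ↔ Valued.v t = Valued.v ϖ ^ n)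
    (hϖmax : ∀ t : M, ρ t = t → Valued.v t < 1 → Valued.v t ≤ Valued.v (jE ϖ))
    (φ : (Fin 2 → E) →+ M) (hφs : ∀ (c : E) (x : Fin 2 → E), φ (c • x) = jE c * φ x) (hφi : Function.Injective φ) (hφo : Function.Surjective φ)
    {γ₂ : GL (Fin 2) E} {lam h : M} (hφγ : ∀ x, φ ((γ₂ : Matrix (Fin 2) (Fin 2) E).mulVec x) = lam * φ x) (hlam : Valued.v lam = 1)
    (hΘh : Θ h = h) (hh : h ≠ 0) (hform : ∀ x y, jE (pairing σ H₂ x y) = h * Θ (φ x) * φ y + ρ (h * Θ (φ x) * φ y))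
    (z : M) (hz1 : Valued.v z = 1) (ξ : E) (hzξ : z * Θ z = jE ξ) (hσξ : σ ξ = ξ) (hξN : ¬ ∃ e : E, e * σ e = ξ)
    (u : E) {b : ℕ} (hb : 1 ≤ b) (hdb : d ≤ b) {j : ℕ} (hlamj : IsOrd ρ α (jE ϖ ^ j) lam)
    (f : ℕ → ℕ → AddSubgroup M → ℕ)
    (hf : ∀ (b j : ℕ) (Λ : AddSubgroup M) (x₀ : M) (r : E), 1 ≤ b → x₀ ≠ 0 →
      (∀ x, x ∈ Λ ↔ ∃ z, IsOrd ρ α (jE ϖ ^ j) z ∧ x = x₀ * z) →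
      IsOrd ρ α (jE ϖ ^ j) (dualGen ρ Θ α (jE ϖ ^ j) h x₀) → ¬ IsOrd ρ α (jE ϖ ^ j) (dualGen ρ Θ α (jE ϖ ^ j) h x₀ / jE ϖ) →
      Valued.v (dualGen ρ Θ α (jE ϖ ^ j) h x₀) = Valued.v (jE ϖ) ^ b →
      (∀ b', (∀ x ∈ Λ, Valued.v (h * Θ x * b' + ρ (h * Θ x * b')) ≤ 1) → (lam - jE u) * b' ∈ Λ) →
      IsOrd ρ α (jE ϖ ^ j) lam → jE r = glueUnit ρ Θ α (jE ϖ ^ j) h (jE ϖ) (jE hW) x₀ b →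
      f b j Λ = Nat.card {x : 𝒪[E] ⧸ 𝓂[E] ^ (2 * b) // ∃ u' : 𝒪[E], Ideal.Quotient.mk (𝓂[E] ^ (2 * b)) u' = x ∧
        Valued.v ((u' : E) * σ u' - r) ≤ Valued.v (ϖ ^ (2 * b))})
    (hfin : (levelSetDep ρ Θ α (jE ϖ) h j b (lam - jE u)).Finite)
    (Pc : AddSubgroup M → Prop) (hPc : ∀ Λ ∈ levelSetDep ρ Θ α (jE ϖ) h j b (lam - jE u), Pc (z • Λ) ↔ Pc Λ)
    (hbal : {Λ ∈ levelSetDep ρ Θ α (jE ϖ) h j b (lam - jE u) | Pc Λ}.ncard = {Λ ∈ levelSetDep ρ Θ α (jE ϖ) h j b (lam - jE u) | ¬ Pc Λ}.ncard)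
    (P₁ Q₁ : AddSubgroup M → Prop)
    (hP₁ : ∀ Λ ∈ levelSetDep ρ Θ α (jE ϖ) h j b (lam - jE u), f b j Λ ≠ 0 → (P₁ Λ ↔ Pc Λ))
    (hQ₁ : ∀ Λ ∈ levelSetDep ρ Θ α (jE ϖ) h j b (lam - jE u), f b j Λ ≠ 0 → (Q₁ Λ ↔ ¬ Pc Λ)) :
    ((∑ᶠ Λ ∈ levelSetDep ρ Θ α (jE ϖ) h j b (lam - jE u) ∩ {Λ | P₁ Λ}, f b j Λ : ℕ) : ℤ) -
      ((∑ᶠ Λ ∈ levelSetDep ρ Θ α (jE ϖ) h j b (lam - jE u) ∩ {Λ | Q₁ Λ}, f b j Λ : ℕ) : ℤ) = 0 := by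
  rw [sub_eq_zero, Nat.cast_inj]
  refine (finsum_levelSetDep_inter_weight_eq_iff_of_le σ hσ hvσ hϖ hD h2v hH₂σ hhW hhWσ jE hρρ hvρ hα hα1 hint hΘΘ hΘρ hvΘ hΘj hjv hjfix hjpow hϖmax
    φ hφs hφi hφo hφγ hlam hΘh hh hform u hb hdb hlamj f hf P₁ Q₁).2 ?_
  -- the two populated labelled parts are the two populated `Π`-halves
  have hP' : {Λ ∈ levelSetDep ρ Θ α (jE ϖ) h j b (lam - jE u) | P₁ Λ ∧ f b j Λ ≠ 0} =
      {Λ ∈ levelSetDep ρ Θ α (jE ϖ) h j b (lam - jE u) | f b j Λ ≠ 0 ∧ Pc Λ} := by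
    ext Λ
    simp only [Set.mem_setOf_eq]
    constructor
    · rintro ⟨hΛ, hP, hw⟩; exact ⟨hΛ, hw, (hP₁ Λ hΛ hw).1 hP⟩
    · rintro ⟨hΛ, hw, hπ⟩; exact ⟨hΛ, (hP₁ Λ hΛ hw).2 hπ, hw⟩
  have hQ' : {Λ ∈ levelSetDep ρ Θ α (jE ϖ) h j b (lam - jE u) | Q₁ Λ ∧ f b j Λ ≠ 0} =
      {Λ ∈ levelSetDep ρ Θ α (jE ϖ) h j b (lam - jE u) | f b j Λ ≠ 0 ∧ ¬ Pc Λ} := by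
    ext Λ
    simp only [Set.mem_setOf_eq]
    constructor
    · rintro ⟨hΛ, hQ, hw⟩; exact ⟨hΛ, hw, (hQ₁ Λ hΛ hw).1 hQ⟩
    · rintro ⟨hΛ, hw, hπ⟩; exact ⟨hΛ, (hQ₁ Λ hΛ hw).2 hπ, hw⟩
  rw [hP', hQ']
  -- the flip as a permutation of `AddSubgroup M`
  set ξ' : M := jE ξ with hξ'def
  have hρξ' : ρ ξ' = ξ' := (hjfix ξ').2 ⟨ξ, rfl⟩
  have hξ'1 : Valued.v ξ' = 1 := by rw [← hzξ, map_mul, hvΘ, hz1, one_mul]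
  have hξ'0 : ξ' ≠ 0 := fun h0 => by rw [h0, map_zero] at hξ'1; exact zero_ne_one hξ'1
  have hz0 : z ≠ 0 := ne_zero_of_mul_map_eq hzξ hξ'0
  let τ : AddSubgroup M ≃ AddSubgroup M :=
    ⟨fun Λ => z • Λ, fun Λ => z⁻¹ • Λ, fun Λ => by simp only [smul_smul, inv_mul_cancel₀ hz0, one_smul],
      fun Λ => by simp only [smul_smul, mul_inv_cancel₀ hz0, one_smul]⟩
  have hτ : ∀ Λ, τ Λ ∈ levelSetDep ρ Θ α (jE ϖ) h j b (lam - jE u) ↔ Λ ∈ levelSetDep ρ Θ α (jE ϖ) h j b (lam - jE u) := fun Λ =>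
    smul_mem_levelSetDep_iff_of_flip hzξ hρξ' hξ'1 (jE ϖ) h j b (lam - jE u) Λ
  have hrev : ∀ Λ ∈ levelSetDep ρ Θ α (jE ϖ) h j b (lam - jE u), f b j (τ Λ) ≠ 0 ↔ f b j Λ = 0 := fun Λ hΛ =>
    weight_smul_ne_zero_iff_weight_eq_zero_of_le σ hσ hvσ hϖ hD h2v hH₂σ hhW hhWσ jE hρρ hvρ hα hα1 hint hΘΘ hΘρ hvΘ hΘj hjv hjfix hjpow hϖmax
      φ hφs hφi hφo hφγ hlam hΘh hh hform z hz1 ξ hzξ hσξ hξN u hb hdb hlamj f hf hΛ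
  exact ncard_sep_and_eq_of_supportReversing_of_invariant _ hfin τ hτ (f b j) Pc hrev (fun Λ hΛ => hPc Λ hΛ) hbal

end Socket

/-! ## §3 The flip letter of the product (exact, datum-free) -/

section FlipLetter

variable {M : Type*} [Field M] {ρ Θ : M →+* M} {α : M}

/-- **THE RAY TRACE OF `z·x₀` IS THAT OF `x₀` DIVIDED BY `ξ' = z·Θz`** (`ρξ' = ξ'`, `Θ` an involution): with `Y = dualGen ρ Θ α cc h x₀`,
`Tr_ρ(μ∕(cc·δ·Θ(dualGen(z·x₀)))) = Tr_ρ(μ∕(cc·δ·ΘY))∕ξ'` (★ `dualGen_mul_left`: `Y(z·x₀) = ξ'·Y`, `Θξ' = ξ'`). [cite: Jacobowitz1962, §4] -/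
theorem rayTrace_mul_left (hΘΘ : ∀ x, Θ (Θ x) = x) {z ξ' : M} (hzξ : z * Θ z = ξ') (hρξ : ρ ξ' = ξ') (cc δ h μ x₀ : M) :
    μ / (cc * δ * Θ (dualGen ρ Θ α cc h (z * x₀))) + ρ (μ / (cc * δ * Θ (dualGen ρ Θ α cc h (z * x₀)))) =
      (μ / (cc * δ * Θ (dualGen ρ Θ α cc h x₀)) + ρ (μ / (cc * δ * Θ (dualGen ρ Θ α cc h x₀)))) / ξ' := by
  have hΘξ : Θ ξ' = ξ' := by rw [← hzξ, map_mul, hΘΘ, mul_comm]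
  rw [dualGen_mul_left hzξ, map_mul Θ ξ', hΘξ,
    show μ / (cc * δ * (ξ' * Θ (dualGen ρ Θ α cc h x₀))) = μ / (cc * δ * Θ (dualGen ρ Θ α cc h x₀)) / ξ' by rw [div_div]; ring_nf,
    map_div₀ ρ _ ξ', hρξ, add_div]

/-- **THE FLIP LETTER OF THE PRODUCT — `glueUnit(z·x₀)·e₀(z·x₀) = (glueUnit(x₀)·e₀(x₀))∕ξ'²`** (`z·Θz = ξ'`, `ρξ' = ξ'`, `ξ' ≠ 0`, `Θ` an involution, `Y(x₀) ≠ 0`; ★ `glueUnit_mul_left`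
+ `rayTrace_mul_left`).  Since `ξ'² = ξ'·σ-norm`, the norm CLASS of the product of the glue unit and the ray scalar is INVARIANT under the exact ω-flip — the flip letter `hPc` of §2
for the MIX-HI band's product character. [cite: Jacobowitz1962, §4] [cite: Serre1979, Ch. V §3 Prop. 5, Cor. 2–3 pp. 84–86] -/
theorem glueUnit_mul_rayTrace_mul_left (hΘΘ : ∀ x, Θ (Θ x) = x) {z ξ' : M} (hzξ : z * Θ z = ξ') (hρξ : ρ ξ' = ξ') (hξ0 : ξ' ≠ 0)
    {cc h x₀ : M} (hY0 : dualGen ρ Θ α cc h x₀ ≠ 0) (ϖE cU δ μ : M) (b : ℕ) :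
    glueUnit ρ Θ α cc h ϖE cU (z * x₀) b *
        (μ / (cc * δ * Θ (dualGen ρ Θ α cc h (z * x₀))) + ρ (μ / (cc * δ * Θ (dualGen ρ Θ α cc h (z * x₀))))) =
      glueUnit ρ Θ α cc h ϖE cU x₀ b * (μ / (cc * δ * Θ (dualGen ρ Θ α cc h x₀)) + ρ (μ / (cc * δ * Θ (dualGen ρ Θ α cc h x₀)))) / ξ' ^ 2 := by
  rw [glueUnit_mul_left hΘΘ hzξ hρξ hξ0 hY0 ϖE cU b, rayTrace_mul_left hΘΘ hzξ hρξ cc δ h μ x₀]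
  field_simp

end FlipLetter

end Summit.HodgeConjecture.HodgeConjecture.Cruxes.H413.F0P3cDyRamConeCellProductSocket

end
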